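import Summits.AtomisticToContinuum.Crystallization.Theorems.OverbindingBudgetAffinePhaseCutA

/-!
(SPLIT FOR THE 400-LINE CAP by the landing lane, hand-2 g35: this file = part 1 of 2; sequels `…OverbindingBudgetAffinePhaseCut` import it in a chain; same namespace, all FQNs unchanged.)
# Overbinding budget — «PhaseCut»: the mesoscopic-roughness kernel MR cut BY STACKING LETTER (decomp-a2c lens-4, generation 75)

Child of `…Theorems.OverbindingBudgetAffineMesoCut` (lens-4 g74, critic row 1307 CLEARED · ADMITTED AS RECORD; slot-3 cone of record
`tbdsg_of_mesoCut_record : K_at⁰ ∧ R_aff ∧ CP⁺ ∧ RC ∧ RS ∧ FC ∧ N2 ∧ Z ∧ MR ∧ FR ⟹ TameBalancedDeepScaleGap (122/125) 0 4 (3/50) (1/450)`).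
Part B (the five census statements · the two seams · the dominance transfer · weaker sides) of a three-part node: part A =
`…Theorems.OverbindingBudgetAffinePhaseCutA` (letters `CFramed`/`HFramed`, proximities `CNear`/`HNear`, the counts, counting identities, shadow packing),
part C = `…Theorems.OverbindingBudgetAffinePhaseCutRecord` (record instances and the slot-3 / RDEF cones BY NAME).
Memo: `HOME/decomp-a2c-lens-4/g75/memo/NODE-g75-PhaseCut.md`.  Probes: `HOME/…/g75/bc/probes_phase.lean`, `bc7_phase.lean`.

## Target and why this leaf
MR `= TameBalancedAffMidGap 64 12 (1/10⁵) (1/25) (3/50) (1/450)` (g43 `…AffineLadder`, cut out of M by g74): every `(64, 3/50)`-deeply registered site having,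
within `12·nn`, a site that is NOT affinely `(10⁻⁵, 1/25)`-registered («rough») pays `c > 0`, against the rebates `#¬deep + #off + N^{2/3} + gains`.
MR is THE leaf of the slot-3 cone tagged IDEA-NEEDED (the non-perturbative kernel of M; g74 memo §6).  RESIDUAL-MODE doctrine: decompose the idea-needed piece.

## Lens-4 reading (minimal counterexample / extremal reduction) and the node
By g74's PROVED L-clean normal form a minimal counterexample family to MR is DEFECT-FREE out to radius `64`: every site in sight is registered, i.e.
two-shell framed by the fcc OR the hcp pattern — the tree's `Framed` carries a LETTER, `c` (`CFramed`) or `h` (`HFramed`), `Framed ↔ CFramed ∨ HFramed`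
(part A `framed_iff`), read by no statement of this route before.  The extremal question «WHICH LETTERS does the minimal counterexample see in the
`12·nn`-ball of a rough site?» has three answers, and they are three different theorems (all at MR's literals, cut radius `r = 12 = ρ₁`):
* **QH** («pure-hexagonal-ball roughness») `:= TameBalancedHexRoughGap 64 12 (1/10⁵) (1/25) (3/50) (1/450) 12` — rough sites with NO `c` within `12·nn`
  pay; `¬deep ∪ (rough ∧ c-proximate)` rebated.  By part A `hFramed_near_of_not_cNear` the priced ball is ALL-`h`: an all-`h` word is `ABAB…`, ONE
  reference structure (the hcp 2-lattice, an objective structure) up to one rigid motion per clean region, no stacking freedom.  Kernel: STRICT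
  nonlinear stability (rate `c` per rough site) of the hcp structure modulo rotations in its `6 %`-registered class — no zeroth-order cushion (hcp is
  the presumed realiser of `e⋆`).  Engines native to exactly this setting: stability constants and discrete Korn inequality for objective structures
  (Schmidt–Steinbach), 2-lattice Cauchy–Born with inner shift (E–Ming 2007), divergence-form first-order consistency (Ortner–Theil 2013), FJM rigidity.
  [NEW · UNDECIDED · IDEA-NEEDED→ATTACKABLE-L · WEAKER: `MR ⇒ QH` PROVED (`hexRough_of_affMid`), `QH ⇏ MR` (probe P2).]
* **QC** («pure-cubic-ball roughness») `:= TameBalancedFccRoughGap 64 12 (1/10⁵) (1/25) (3/50) (1/450) 12` — rough sites with a `c` and NO `h` within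
  `12·nn` pay; `¬deep ∪ (rough ∧ two-letter ball)` rebated.  By `cFramed_near_of_not_hNear` the priced ball is ALL-`c` = fcc, a BRAVAIS lattice, and
  EVERY site of it carries the zeroth-order cushion `J = e_fcc − e⋆ ≥ e_fcc − e_hcp ≈ 7·10⁻⁵` (hcp is periodic, so `e⋆ ≤ e_hcp`; lattice sums
  `A₆ = 14.45392 / 14.45489`, `A₁₂ = 12.13188 / 12.13229`, `e = −A₆²/(24A₁₂)`: `−0.717518 / −0.717590`).  Kernel: the GAIN-ZERO local minimality of the
  fcc lattice modulo rotations in its registered class (`Σ_grain (E_i − e_fcc) ≥ −C·#∂grain`), STRICTNESS being supplied by `J` per site, not by a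
  coercivity constant — plus a two-lattice-sum certificate `e_fcc − e_hcp > 0` and the smooth-interface flux bound `≲ 5κ ≤ J/5` at `κ ≤ 2.5·10⁻⁶`.
  Engines: Cauchy–Born validity near `SO(n)` for mass–spring models (Conti–Dolzmann–Kirchheim–Müller 2006), lattice stability constants (Hudson–Ortner),
  atomistic/continuum local minimisers (E–Ming 2007, Ortner–Theil 2013, Braun–Schmidt 2013/16).  [NEW · UNDECIDED · ATTACKABLE-L (the most attackable
  statement of the slot-3 cone after the CERT leaves) · WEAKER: `PC ⇒ QC` PROVED, `QC ⇏ PC`, `QC ⇏ MR` (probes).]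
* **PM** («two-letter-ball roughness») `:= TameBalancedMixedRoughGap 64 12 (1/10⁵) (1/25) (3/50) (1/450) 12` — rough sites with BOTH letters within
  `12·nn` (a STACKING INTERFACE within `12·nn`) pay, MR's rebates.  Kernel: strict stability of relaxed Barlow stackings modulo rotations within `24·nn` of
  stacking interfaces, partial cushion `J` per `c`-site of the ball.  [NEW · UNDECIDED · IDEA-NEEDED (the residual two-phase kernel of MR, now CONFINED to
  interface neighbourhoods) · WEAKER: `PC ⇒ PM` PROVED, `PM ⇏ PC` (probe).]
* **PC** («cubic-proximate roughness») `:= TameBalancedCubicRoughGap … 12` = the intermediate AND-node `QC ∧ PM ⇒ PC ⇒ QC ∧ PM` (seam 2; rough sites with a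
  `c` within `12·nn` pay, MR's rebates).  [WEAKER than MR, PROVED.]
* **HD** («hexagonal dominance», transfer target) `:= HexagonalDominance := TameBalancedCubicGap 4 (3/50) (1/450)` — EVERY `(4, 3/50)`-deeply registered
  `c`-lettered site pays, rebates `#¬deep₄ + #off + N^{2/3} + gains`.  `HD ⇒ PC` PROVED (`tameBalancedCubicRoughGap_of_cubicGap`, shadow packing,
  `12·(4+1) = 60 ≤ 64`).  [NEW · UNDECIDED · STRONGER than PC · NOT on the weaker side of MR (it prices IDEAL fcc, MR does not; probes P3/P4) · kernel =
  gain-zero local minimality of EVERY relaxed Barlow stacking modulo rotations + the full STACKING GAP `inf_{w ≠ h^∞} (e_w − e_hcp)/φ_c(w) > 0` (`φ_c` =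
  fraction of `c`-layers; CERT ask ⑪; hcp is the zero-pressure polytype ground state with full relaxation, Pártay–Ortner–Bartók–Pickard–Csányi 2017
  arXiv:1705.01751 §3, Bétermin–Šamaj–Travěnec 2021 arXiv:2107.14020 §3 for lattices+HCP) · filed to DOCUMENT that on the cubic side strictness is polytype
  ENERGETICS, a 1D word problem; WHY IT MIGHT FAIL: a relaxed polytype within `o(φ_c)` of hcp.]
* **SEAMS (PROVED, 0 sorry)**: `QH ∧ PC ⇒ MR` (`balancedAffMidGapW_of_phaseCut`) and `QC ∧ PM ⇒ PC` (`balancedCubicRoughGapW_of_letterCut`), both g41's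
  `convexComb_core` BY NAME over the partitions `#MID_aff ≤ #cubicRough + #hexRough`, `#cubicRough ≤ #fccRough + #mixedRough`; hence `QH ∧ QC ∧ PM ⇒ MR`
  (`tameBalancedAffMidGap_of_letterCut`) and `HD ∧ QH ⇒ MR`.  Converses `MR ⇒ QH ∧ QC ∧ PM ∧ PC` PROVED: the cut loses nothing.  Part C: slot-3 cones
  `tbdsg_of_letterCut_record : K_at⁰ ∧ R_aff ∧ CP⁺ ∧ RC ∧ RS ∧ FC ∧ N2 ∧ Z ∧ QH ∧ QC ∧ PM ∧ FR ⟹ TBDSG_rec`, `tbdsg_of_dominance_record : … ∧ HD ∧ QH ∧ FR ⟹ TBDSG_rec`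
  through g74's `tbdsg_of_mesoCut_record`, and the RDEF shape.

## Why each piece is STRICTLY WEAKER than MR, and not a rewording
Each of QH, QC, PM prices a sub-class of MR's priced set with MR's rebates or more; the three classes are pairwise disjoint, so no piece implies another
or MR (probes).  Word test: MR = «rough registered LJ matter pays»; QH = «rough matter inside locally perfect hcp STACKING pays» (one 2-lattice, strict
elasticity); QC = «rough matter inside locally perfect fcc stacking pays» (one Bravais lattice, gain-zero minimality + the number `e_fcc − e_hcp > 0`);
PM = «rough matter at a stacking interface pays» (polytypes).  Three different reference classes, three different literatures; the idea-needed content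
of MR is split into a single-structure strict-stability statement (QH), a single-lattice NON-strict one (QC) and an interface statement (PM).
Record literals: `r = 12 = ρ₁` (the rough witness's ball is the single-phase ball), HD depth `4` = the registration frame of record; NO new literal.
QH is monotone in `r` upward (`hexRoughCount_anti_radius`), PM's class grows with `r`; later seats may move the single-phase radius.

## Why novel (relative to the tree and the cell)
(i) First cut of ANY slot-3 statement by the STACKING LETTER: 75 generations quantified `P = fcc ∨ P = hcp` symmetrically (g41 tolerance, g43 affine
quality, g47 localisation, g44–g73 near/far strain classes and skeleton surfaces, g74 second tolerance); `CFramed`/`HFramed`/`CNear`/`HNear` are new tree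
vocabulary, `framed_iff` and the two single-phase normal forms new tree lemmas.  (ii) It brings POLYTYPE ENERGETICS (layer words, the stacking gap) into the
route as typed statements with one-number falsifiers, and the observation that in cubic-lettered matter STRICTNESS IS FREE (`J` per site): QC needs only
gain-zero minimality of a Bravais lattice — the setting of CDKM 2006 / Hudson–Ortner / Braun–Schmidt verbatim.  (iii) It confines the genuinely two-phase
kernel to `PM`, i.e. to `24·nn`-neighbourhoods of stacking interfaces.

## Census asks (LOW) ⑪ «stacking gap» and ⑫ «single-phase roughness»
⑪: for `V = r⁻¹²/12 − r⁻⁶/6` (untruncated, zero pressure): (a) CERT `e_fcc,min − e_hcp,min ≥ 6·10⁻⁵` (interval lattice sums with tail bounds — the QC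
cushion); (b) relaxed energies per site of all Barlow words of period `≤ 12` and of the isolated faults I₁, I₂, E, T in hcp; report `min_w (e_w − e_hcp)/φ_c(w)`
(PASS `> 0` with margin `≳ 10⁻⁵` supports HD; FAIL refutes HD and, if the minimiser is `10⁻⁵`-rough, MR and M).  ⑫: g74's ⑩ texture zoo SPLIT BY LETTER:
pure hcp / pure fcc / faulted (bent and twisted slabs, frozen phonons `10⁻⁴–10⁻²`, `≤ 6 %` strain with inner relaxation): `#hexRough`, `#fccRough`, `#mixedRough`
at `(64 → 12, 10⁻⁵)` against `(𝓔 − N e⋆) + #¬deep₆₄ + #off + N^{2/3}`.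

## Dead ends booked this generation (memo §8)
pricing LETTER CHANGES themselves (ideal faults are unrough: not implied by MR, and not owed by RDEF — stacking-disordered ideal packings pass the gapped-twelve
test); «HD is zeroth-order in rough matter» (false as a proof plan: in rough two-phase matter HD needs the same modulo-rotation minimality as MR's pieces,
gain zero — recorded honestly in its tag); equilibrium (force-balance) reduction of the minimal counterexample (relaxation destroys the priced quantity);
local density dichotomy of roughness (padding); amplitude cut R1/R2 by the distortion `θ` (a dial of g43's, cosmetic); sitewise `h`-dominance (false at first
order: `L_i ≈ 0.5|DF|` at hcp sites, `D_3h` is not centrosymmetric).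

sorry-free · Mathlib + tree only · no new axioms · no instance / notation beyond the tree's file-local `E3` · every seam by NAME (`convexComb_core`,
`card_le_of_cube`, `notDeepCount_mono`).
-/

namespace Summit.AtomisticToContinuum.Crystallization.Theorems.OverbindingBudgetAffinePhaseCut

open scoped BigOperators Classical
open Literature.MathematicalPhysics.StatisticalMechanics
open Literature.Geometry.DiscreteGeometry (IsChargeFree nearestDist nearestDist_nonneg nearestDist_le_dist)
open Summit.AtomisticToContinuum.Crystallization.Theorems.OverbindingBudgetMisfitRegistration (Framed Reg DeepReg)
open Summit.AtomisticToContinuum.Crystallization.Theorems.OverbindingBudgetMisfitWindowStatements (InWindow offCount)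
open Summit.AtomisticToContinuum.Crystallization.Theorems.OverbindingBudgetBalancedCensusStatements
open Summit.AtomisticToContinuum.Crystallization.Theorems.OverbindingBudgetHarmonicNormalForm (convexComb_core)
open Summit.AtomisticToContinuum.Crystallization.Theorems.OverbindingBudgetAffineLadder
open Summit.AtomisticToContinuum.Crystallization.Theorems.OverbindingBudgetAffineMesoCut

variable {N : ℕ}

local notation "E3" => EuclideanSpace ℝ (Fin 3)

/-! ## §4  THE STATEMENTS OF THE CUT (census shape of the tree; NEW, UNDECIDED) -/

/-- **PC_W** («cubic-proximate roughness is priced», one window): `c > 0` per `(ρ, ε)`-deep, not affinely `(ρ₁, ε₁, θ)`-deep site having a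
CUBIC-lettered site within `r·nn`, against `#¬(ρ,ε)-deep + #off + N^{2/3} + gains`.  The intermediate AND-node `QC ∧ PM`. [this file · kind: statement] -/
def BalancedCubicRoughGapW (ρ ρ₁ ε₁ θ ε g r σ₁ σ₂ : ℝ) : Prop :=
  ∃ c C : ℝ, 0 < c ∧ ∀ (N : ℕ) (y : Fin N → E3), Function.Injective y →
    ∃ u : E3, ‖u‖ = 1 ∧
      (N : ℝ) * (⨅ Q : PeriodicConfiguration 3, Q.energyPerParticle lennardJones) + c * (cubicRoughCount ρ ρ₁ ε₁ θ ε g r y : ℝ)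
        - C * (notDeepCount ρ ε g y : ℝ) - C * (offCount σ₁ σ₂ y : ℝ) - C * (N : ℝ) ^ (2 / 3 : ℝ) - C * (dilGain y + shGain u y)
        ≤ interactionEnergy lennardJones y

/-- **PC** (tame): `BalancedCubicRoughGapW … δ 2` for every window `[δ, 2]`, `0 < δ ≤ 2`. -/
def TameBalancedCubicRoughGap (ρ ρ₁ ε₁ θ ε g r : ℝ) : Prop :=
  ∀ δ : ℝ, 0 < δ → δ ≤ 2 → BalancedCubicRoughGapW ρ ρ₁ ε₁ θ ε g r δ 2

/-- **QH_W** («pure-hexagonal-ball roughness is priced», one window): `c > 0` per `(ρ, ε)`-deep, not affinely `(ρ₁, ε₁, θ)`-deep site with NO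
cubic-lettered site within `r·nn`, against `#(¬(ρ,ε)-deep) + #cubicRough + #off + N^{2/3} + gains` (the cubic-proximate rough sites are REBATED).
[this file · kind: statement] -/
def BalancedHexRoughGapW (ρ ρ₁ ε₁ θ ε g r σ₁ σ₂ : ℝ) : Prop :=
  ∃ c C : ℝ, 0 < c ∧ ∀ (N : ℕ) (y : Fin N → E3), Function.Injective y →
    ∃ u : E3, ‖u‖ = 1 ∧
      (N : ℝ) * (⨅ Q : PeriodicConfiguration 3, Q.energyPerParticle lennardJones) + c * (hexRoughCount ρ ρ₁ ε₁ θ ε g r y : ℝ)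
        - C * ((notDeepCount ρ ε g y + cubicRoughCount ρ ρ₁ ε₁ θ ε g r y : ℕ) : ℝ) - C * (offCount σ₁ σ₂ y : ℝ)
        - C * (N : ℝ) ^ (2 / 3 : ℝ) - C * (dilGain y + shGain u y)
        ≤ interactionEnergy lennardJones y

/-- **QH** (tame). -/
def TameBalancedHexRoughGap (ρ ρ₁ ε₁ θ ε g r : ℝ) : Prop :=
  ∀ δ : ℝ, 0 < δ → δ ≤ 2 → BalancedHexRoughGapW ρ ρ₁ ε₁ θ ε g r δ 2

/-- **QC_W** («pure-cubic-ball roughness is priced», one window): `c > 0` per `(ρ, ε)`-deep, not affinely `(ρ₁, ε₁, θ)`-deep, cubic-proximate site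
with NO hexagonal-lettered site within `r·nn`, against `#(¬(ρ,ε)-deep) + #mixedRough + #off + N^{2/3} + gains` (two-letter-ball rough sites REBATED).
[this file · kind: statement] -/
def BalancedFccRoughGapW (ρ ρ₁ ε₁ θ ε g r σ₁ σ₂ : ℝ) : Prop :=
  ∃ c C : ℝ, 0 < c ∧ ∀ (N : ℕ) (y : Fin N → E3), Function.Injective y →
    ∃ u : E3, ‖u‖ = 1 ∧
      (N : ℝ) * (⨅ Q : PeriodicConfiguration 3, Q.energyPerParticle lennardJones) + c * (fccRoughCount ρ ρ₁ ε₁ θ ε g r y : ℝ)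
        - C * ((notDeepCount ρ ε g y + mixedRoughCount ρ ρ₁ ε₁ θ ε g r y : ℕ) : ℝ) - C * (offCount σ₁ σ₂ y : ℝ)
        - C * (N : ℝ) ^ (2 / 3 : ℝ) - C * (dilGain y + shGain u y)
        ≤ interactionEnergy lennardJones y

/-- **QC** (tame). -/
def TameBalancedFccRoughGap (ρ ρ₁ ε₁ θ ε g r : ℝ) : Prop :=
  ∀ δ : ℝ, 0 < δ → δ ≤ 2 → BalancedFccRoughGapW ρ ρ₁ ε₁ θ ε g r δ 2

/-- **PM_W** («two-letter-ball roughness is priced», one window): `c > 0` per `(ρ, ε)`-deep, not affinely `(ρ₁, ε₁, θ)`-deep site with BOTH a cubic- and a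
hexagonal-lettered site within `r·nn`, against `#¬(ρ,ε)-deep + #off + N^{2/3} + gains`. [this file · kind: statement] -/
def BalancedMixedRoughGapW (ρ ρ₁ ε₁ θ ε g r σ₁ σ₂ : ℝ) : Prop :=
  ∃ c C : ℝ, 0 < c ∧ ∀ (N : ℕ) (y : Fin N → E3), Function.Injective y →
    ∃ u : E3, ‖u‖ = 1 ∧
      (N : ℝ) * (⨅ Q : PeriodicConfiguration 3, Q.energyPerParticle lennardJones) + c * (mixedRoughCount ρ ρ₁ ε₁ θ ε g r y : ℝ)
        - C * (notDeepCount ρ ε g y : ℝ) - C * (offCount σ₁ σ₂ y : ℝ) - C * (N : ℝ) ^ (2 / 3 : ℝ) - C * (dilGain y + shGain u y)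
        ≤ interactionEnergy lennardJones y

/-- **PM** (tame). -/
def TameBalancedMixedRoughGap (ρ ρ₁ ε₁ θ ε g r : ℝ) : Prop :=
  ∀ δ : ℝ, 0 < δ → δ ≤ 2 → BalancedMixedRoughGapW ρ ρ₁ ε₁ θ ε g r δ 2

/-- **HD_W** («hexagonal dominance», one window): `c > 0` per `(ρc, ε)`-deeply registered CUBIC-lettered site, against `#¬(ρc,ε)-deep + #off +
N^{2/3} + gains` — fcc-type stacking is never the zero-pressure ground state of the tree's Lennard-Jones, by a margin proportional to the number of
cubic-lettered sites (the STACKING GAP), robustly under `6 %` registration. [this file · kind: statement] -/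
def BalancedCubicGapW (ρc ε g σ₁ σ₂ : ℝ) : Prop :=
  ∃ c C : ℝ, 0 < c ∧ ∀ (N : ℕ) (y : Fin N → E3), Function.Injective y →
    ∃ u : E3, ‖u‖ = 1 ∧
      (N : ℝ) * (⨅ Q : PeriodicConfiguration 3, Q.energyPerParticle lennardJones) + c * (cubicCount ρc ε g y : ℝ)
        - C * (notDeepCount ρc ε g y : ℝ) - C * (offCount σ₁ σ₂ y : ℝ) - C * (N : ℝ) ^ (2 / 3 : ℝ) - C * (dilGain y + shGain u y)
        ≤ interactionEnergy lennardJones y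

/-- **HD** (tame). -/
def TameBalancedCubicGap (ρc ε g : ℝ) : Prop :=
  ∀ δ : ℝ, 0 < δ → δ ≤ 2 → BalancedCubicGapW ρc ε g δ 2

/-- **`HexagonalDominance`** — HD at the registration frame of record `(4, 3/50, 1/450)`. [this file · kind: statement] -/
def HexagonalDominance : Prop :=
  TameBalancedCubicGap 4 (3 / 50) (1 / 450)

/-! ## §5  THE TWO SEAMS (PROVED): QH_W ∧ PC_W ⇒ MID_aff,W and QC_W ∧ PM_W ⇒ PC_W -/

/-- **Seam 1 at one window**: `QH_W ∧ PC_W ⇒ MID_aff,W`.  Arithmetic = g41's `convexComb_core` BY NAME (QH plays the fine leaf: it prices the pure-hexagonal-ball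
rough sites and rebates `¬deep ∪ cubicRough`; PC prices the latter); the shear direction is the one of larger gain. [this file] -/
theorem balancedAffMidGapW_of_phaseCut {ρ ρ₁ ε₁ θ ε g r σ₁ σ₂ : ℝ}
    (hQ : BalancedHexRoughGapW ρ ρ₁ ε₁ θ ε g r σ₁ σ₂) (hP : BalancedCubicRoughGapW ρ ρ₁ ε₁ θ ε g r σ₁ σ₂) :
    BalancedAffMidGapW ρ ρ₁ ε₁ θ ε g σ₁ σ₂ := by
  obtain ⟨c₁, C₁, hc₁, h₁⟩ := hQ
  obtain ⟨c₂, C₂, hc₂, h₂⟩ := hP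
  have hP₁0 : 0 ≤ max C₁ 0 := le_max_right _ _
  have hK : 0 < max C₁ 0 + c₂ + 1 := by linarith
  set t : ℝ := c₂ / (4 * (max C₁ 0 + c₂ + 1)) with ht
  have ht0 : 0 < t := by rw [ht]; positivity
  have ht4 : t ≤ 1 / 4 := by
    rw [ht, div_le_iff₀ (by positivity)]
    nlinarith
  have htP : t * max C₁ 0 ≤ c₂ / 4 := by
    rw [ht, div_mul_eq_mul_div, div_le_iff₀ (by positivity)]
    nlinarith [mul_nonneg hc₂.le hP₁0, mul_nonneg hc₂.le hc₂.le]
  set m : ℝ := min (t * c₁) (c₂ / 4) with hm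
  have hm0 : 0 < m := lt_min (mul_pos ht0 hc₁) (by positivity)
  refine ⟨m, max C₁ 0 + max C₂ 0, hm0, fun N y hy => ?_⟩
  obtain ⟨u₁, hu₁, H₁⟩ := h₁ N y hy
  obtain ⟨u₂, hu₂, H₂⟩ := h₂ N y hy
  have hRc : (affMidCount ρ ρ₁ ε₁ θ ε g y : ℝ) ≤ hexRoughCount ρ ρ₁ ε₁ θ ε g r y + cubicRoughCount ρ ρ₁ ε₁ θ ε g r y := by
    have := affMidCount_le_cubicRough_add_hexRough (ρ := ρ) (ρ₁ := ρ₁) (ε₁ := ε₁) (θ := θ) (ε := ε) (g := g) (r := r) y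
    push_cast [add_comm] at this ⊢
    exact_mod_cast (by omega)
  have hDc : (((notDeepCount ρ ε g y + cubicRoughCount ρ ρ₁ ε₁ θ ε g r y : ℕ) : ℝ))
      ≤ notDeepCount ρ ε g y + cubicRoughCount ρ ρ₁ ε₁ θ ε g r y := by
    push_cast
    exact le_rfl
  have n1 : (0 : ℝ) ≤ hexRoughCount ρ ρ₁ ε₁ θ ε g r y := Nat.cast_nonneg _
  have n2 : (0 : ℝ) ≤ cubicRoughCount ρ ρ₁ ε₁ θ ε g r y := Nat.cast_nonneg _
  have n3 : (0 : ℝ) ≤ notDeepCount ρ ε g y := Nat.cast_nonneg _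
  have n4 : (0 : ℝ) ≤ (((notDeepCount ρ ε g y + cubicRoughCount ρ ρ₁ ε₁ θ ε g r y : ℕ) : ℝ)) := Nat.cast_nonneg _
  have n5 : (0 : ℝ) ≤ offCount σ₁ σ₂ y := Nat.cast_nonneg _
  have n6 : (0 : ℝ) ≤ (N : ℝ) ^ (2 / 3 : ℝ) := Real.rpow_nonneg (Nat.cast_nonneg _) _
  have g1 : 0 ≤ dilGain y + shGain u₁ y := add_nonneg (dilGain_nonneg y) (shGain_nonneg _ y)
  have g2 : 0 ≤ dilGain y + shGain u₂ y := add_nonneg (dilGain_nonneg y) (shGain_nonneg _ y)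
  rcases le_total (shGain u₁ y) (shGain u₂ y) with hle | hle
  · refine ⟨u₂, hu₂, ?_⟩
    exact convexComb_core H₁ H₂ hRc hDc n1 n2 n3 n4 n5 n6 g1 g2 (by linarith) le_rfl hc₂ ht0 ht4 htP hm0.le
      (min_le_left _ _) (min_le_right _ _)
  · refine ⟨u₁, hu₁, ?_⟩
    exact convexComb_core H₁ H₂ hRc hDc n1 n2 n3 n4 n5 n6 g1 g2 le_rfl (by linarith) hc₂ ht0 ht4 htP hm0.le
      (min_le_left _ _) (min_le_right _ _)

/-- **Seam 1 (tame)**: `QH ∧ PC ⇒ TameBalancedAffMidGap`. [this file] -/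
theorem tameBalancedAffMidGap_of_phaseCut {ρ ρ₁ ε₁ θ ε g r : ℝ} (hQ : TameBalancedHexRoughGap ρ ρ₁ ε₁ θ ε g r)
    (hP : TameBalancedCubicRoughGap ρ ρ₁ ε₁ θ ε g r) : TameBalancedAffMidGap ρ ρ₁ ε₁ θ ε g :=
  fun δ hδ hδ2 => balancedAffMidGapW_of_phaseCut (hQ δ hδ hδ2) (hP δ hδ hδ2)

/-- **Seam 2 at one window**: `QC_W ∧ PM_W ⇒ PC_W` (`convexComb_core` BY NAME: QC prices the pure-cubic-ball rough sites and rebates `¬deep ∪ mixedRough`; PM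
prices the latter). [this file] -/
theorem balancedCubicRoughGapW_of_letterCut {ρ ρ₁ ε₁ θ ε g r σ₁ σ₂ : ℝ}
    (hQ : BalancedFccRoughGapW ρ ρ₁ ε₁ θ ε g r σ₁ σ₂) (hP : BalancedMixedRoughGapW ρ ρ₁ ε₁ θ ε g r σ₁ σ₂) :
    BalancedCubicRoughGapW ρ ρ₁ ε₁ θ ε g r σ₁ σ₂ := by
  obtain ⟨c₁, C₁, hc₁, h₁⟩ := hQ
  obtain ⟨c₂, C₂, hc₂, h₂⟩ := hP
  have hP₁0 : 0 ≤ max C₁ 0 := le_max_right _ _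
  have hK : 0 < max C₁ 0 + c₂ + 1 := by linarith
  set t : ℝ := c₂ / (4 * (max C₁ 0 + c₂ + 1)) with ht
  have ht0 : 0 < t := by rw [ht]; positivity
  have ht4 : t ≤ 1 / 4 := by
    rw [ht, div_le_iff₀ (by positivity)]
    nlinarith
  have htP : t * max C₁ 0 ≤ c₂ / 4 := by
    rw [ht, div_mul_eq_mul_div, div_le_iff₀ (by positivity)]
    nlinarith [mul_nonneg hc₂.le hP₁0, mul_nonneg hc₂.le hc₂.le]
  set m : ℝ := min (t * c₁) (c₂ / 4) with hm
  have hm0 : 0 < m := lt_min (mul_pos ht0 hc₁) (by positivity)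
  refine ⟨m, max C₁ 0 + max C₂ 0, hm0, fun N y hy => ?_⟩
  obtain ⟨u₁, hu₁, H₁⟩ := h₁ N y hy
  obtain ⟨u₂, hu₂, H₂⟩ := h₂ N y hy
  have hRc : (cubicRoughCount ρ ρ₁ ε₁ θ ε g r y : ℝ) ≤ fccRoughCount ρ ρ₁ ε₁ θ ε g r y + mixedRoughCount ρ ρ₁ ε₁ θ ε g r y := by
    exact_mod_cast cubicRoughCount_le_fccRough_add_mixedRough y
  have hDc : (((notDeepCount ρ ε g y + mixedRoughCount ρ ρ₁ ε₁ θ ε g r y : ℕ) : ℝ))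
      ≤ notDeepCount ρ ε g y + mixedRoughCount ρ ρ₁ ε₁ θ ε g r y := by
    push_cast
    exact le_rfl
  have n1 : (0 : ℝ) ≤ fccRoughCount ρ ρ₁ ε₁ θ ε g r y := Nat.cast_nonneg _
  have n2 : (0 : ℝ) ≤ mixedRoughCount ρ ρ₁ ε₁ θ ε g r y := Nat.cast_nonneg _
  have n3 : (0 : ℝ) ≤ notDeepCount ρ ε g y := Nat.cast_nonneg _
  have n4 : (0 : ℝ) ≤ (((notDeepCount ρ ε g y + mixedRoughCount ρ ρ₁ ε₁ θ ε g r y : ℕ) : ℝ)) := Nat.cast_nonneg _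
  have n5 : (0 : ℝ) ≤ offCount σ₁ σ₂ y := Nat.cast_nonneg _
  have n6 : (0 : ℝ) ≤ (N : ℝ) ^ (2 / 3 : ℝ) := Real.rpow_nonneg (Nat.cast_nonneg _) _
  have g1 : 0 ≤ dilGain y + shGain u₁ y := add_nonneg (dilGain_nonneg y) (shGain_nonneg _ y)
  have g2 : 0 ≤ dilGain y + shGain u₂ y := add_nonneg (dilGain_nonneg y) (shGain_nonneg _ y)
  rcases le_total (shGain u₁ y) (shGain u₂ y) with hle | hle
  · refine ⟨u₂, hu₂, ?_⟩
    exact convexComb_core H₁ H₂ hRc hDc n1 n2 n3 n4 n5 n6 g1 g2 (by linarith) le_rfl hc₂ ht0 ht4 htP hm0.le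
      (min_le_left _ _) (min_le_right _ _)
  · refine ⟨u₁, hu₁, ?_⟩
    exact convexComb_core H₁ H₂ hRc hDc n1 n2 n3 n4 n5 n6 g1 g2 le_rfl (by linarith) hc₂ ht0 ht4 htP hm0.le
      (min_le_left _ _) (min_le_right _ _)

/-- **Seam 2 (tame)**: `QC ∧ PM ⇒ PC`. [this file] -/
theorem tameBalancedCubicRoughGap_of_letterCut {ρ ρ₁ ε₁ θ ε g r : ℝ} (hQ : TameBalancedFccRoughGap ρ ρ₁ ε₁ θ ε g r)
    (hP : TameBalancedMixedRoughGap ρ ρ₁ ε₁ θ ε g r) : TameBalancedCubicRoughGap ρ ρ₁ ε₁ θ ε g r :=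
  fun δ hδ hδ2 => balancedCubicRoughGapW_of_letterCut (hQ δ hδ hδ2) (hP δ hδ hδ2)

/-- **THE CUT (tame form; the AND-node of this file)**: `QH ∧ QC ∧ PM ⇒ TameBalancedAffMidGap`. [this file] -/
theorem tameBalancedAffMidGap_of_letterCut {ρ ρ₁ ε₁ θ ε g r : ℝ} (hQH : TameBalancedHexRoughGap ρ ρ₁ ε₁ θ ε g r)
    (hQC : TameBalancedFccRoughGap ρ ρ₁ ε₁ θ ε g r) (hPM : TameBalancedMixedRoughGap ρ ρ₁ ε₁ θ ε g r) :
    TameBalancedAffMidGap ρ ρ₁ ε₁ θ ε g :=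
  tameBalancedAffMidGap_of_phaseCut hQH (tameBalancedCubicRoughGap_of_letterCut hQC hPM)

end Summit.AtomisticToContinuum.Crystallization.Theorems.OverbindingBudgetAffinePhaseCut
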